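import Mathlib
import HarnessLib
import Summits.HubbardSuperconductivity.HubbardSuperconductivity.Theorems.KLProgrammeKLRegimeEnginePairTransferCrossScaleMass

/-!
# Route `KLProgramme` — ENGINE item stmt-HubbardSuperconductivity-20437 `KLRegimeEngineV17F2`, stub (c) value lane, «XS-PP-MASS» (part 2, the bound):
# `Σ_p |tₙ[φ](Qm,p)| ≤ (90κ_G·klTS + 2¹⁸)·(klRelGain n ρ + 2⁻ⁿ)` at a frozen total momentum `ρ = |p_Qm|_𝕋 ≥ Λₙ`
# (cell gate-hubbard-kl, seat hubbard-kl-k3c2-p2 g19; memo HOME/hubbard-kl-k3c2-p2/OUT-OF-CLASS-E2.md §8–§9a; plan g23 (R237))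

Assembly of …PairTransferCrossScaleMass: the mass under the dyadic envelope (`sum_abs_klTransferWeight_le_env`), the envelope expanded over the hard shells
`j ≤ n` (`sum_klDyadicEnv_mul_eq`), each shell's slice sum under its restricted soft sum (`sum_indicator_slice_le_softSum`), and then, shell by shell:
the TWO-SHELL law (`softSum_filter_le_linear` ∘ `card_twoShell_filter_le_linear`) on the shells `1 ≤ j ≤ n` with `Λ_j ≤ ρ` — one unit `(5/4)·Λₙ/ρ` each (their
number is the shell count `kₙ(ρ) = klShellCount n ρ`) plus a caustic `√(2Λ_j)` term whose sum over `j` is `≤ 2√2·√Λₙ ∝ 2⁻ⁿ` (`sum_range_klScale_mul_sqrt_div_le`) —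
and the SINGLE-SHELL law (`sum_softLine_le_of_frameOK`, `15367·Λₙ·βL²`) on the top shell `j = 0`, on the shells above `ρ` (geometric: `Σ_{ρ<Λ_j} Λₙ/Λ_j ≤ (4/3)Λₙ/ρ`,
`sum_filter_div_klScale_le`) and on the UV part of the envelope.  Result:
**`sum_abs_klTransferWeight_le_shellLog`** — for `FrameOK R U N μ K`, `R.WF2`, `0 < U ≤ klTSU R`, `μ ∈ klWindowC`, `klBetaMin ≤ β ≤ L`, `n ≤ nScales β`, `8Gβ ≤ L`,
a soft fraction `0 ≤ φ ≤ 1 − w^K_{Λₙ}` and `Λₙ ≤ ρ = |p_Qm|_𝕋`: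
`Σ_p |tₙ[φ](Qm,p)| ≤ (90·κ_G·klTS + 2¹⁸)·(klRelGain n ρ + 2⁻ⁿ)`, `κ_G = 7/(4π²) + 2G/π`, `G = 4 + (8/3)Gfr₁U²` —
the shape `C·(klRelGain n (ρ⊔0) + 2⁻ⁿ)` of the pp shell-log addend `GeoConsts.addShellLogPP` (…SplitGeoShellLogPP; token candidate `klEngGeo12`).  The reading for the
un-smearing step (iii) of (E2″-F) out of class: with the a priori `m² ≤ 2⁸(Klam U)²` and Neumann's `3/2`, `(3/2)·m²·Σ_p|t| ≤ (Klam U)²·384·(90κ_G klTS + 2¹⁸)·(…)`, inside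
`(Klam U)²·(klTSA + 2²⁸)·(klRelGain + 2⁻ⁿ)` since `384·90·κ_G ≤ 2⁶⁰` for `G ≤ 2²¹` and `384·2¹⁸ < 2²⁷`.
Exact arithmetic over landed lemmas; nothing asserts (E2″-F), (c), K3 or superconductivity.  0 kit · 0 lit.
-/

noncomputable section

namespace Summit.HubbardSuperconductivity.HubbardSuperconductivity.Theorems.KLRegimeSplit

set_option linter.dupNamespace false -- summit = problem name (single-conjunct summit), D-0017

open Real Finset Complex Literature.MathematicalPhysics.QuantumLattice Literature.Probability.LatticeModels
open Summit.HubbardSuperconductivity.HubbardSuperconductivity.Theorems.KLProgrammeLegKernels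
open Summit.HubbardSuperconductivity.HubbardSuperconductivity.Theorems.TwoPointAssembly
open Summit.HubbardSuperconductivity.HubbardSuperconductivity.Theorems.DispersionFlow
open Summit.HubbardSuperconductivity.HubbardSuperconductivity.Theorems.EngineV8

/-! ## §1 Scalar helpers on the scale ladder -/

/-- `Λₙ·√Λ_j/Λ_j = √Λₙ·(1/2)^{n−j}` for `j ≤ n`. -/
theorem klScale_mul_sqrt_div_eq {j n : ℕ} (hjn : j ≤ n) :
    klScale klE0 n * (Real.sqrt (klScale klE0 j) / klScale klE0 j) = Real.sqrt (klScale klE0 n) * ((1 : ℝ) / 2) ^ (n - j) := by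
  have hΛj : 0 < klScale klE0 j := klth_klScale_pos j
  have hΛn : 0 < klScale klE0 n := klth_klScale_pos n
  have hrel : klScale klE0 j = (4 : ℝ) ^ (n - j) * klScale klE0 n := by
    rw [klScale_eq_pow_mul_of_le hjn]
    field_simp
  have h4 : (4 : ℝ) ^ (n - j) = ((2 : ℝ) ^ (n - j)) ^ 2 := by rw [sq, ← mul_pow]; norm_num
  have hsq : Real.sqrt (klScale klE0 j) = (2 : ℝ) ^ (n - j) * Real.sqrt (klScale klE0 n) := by
    rw [hrel, h4, Real.sqrt_mul (by positivity), Real.sqrt_sq (by positivity)]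
  rw [hsq, hrel, h4, one_div, inv_pow]
  field_simp

/-- **The caustic sum**: `Σ_{j ≤ n} Λₙ·√Λ_j/Λ_j ≤ 2·√Λₙ`. -/
theorem sum_range_klScale_mul_sqrt_div_le (n : ℕ) :
    ∑ j ∈ range (n + 1), klScale klE0 n * (Real.sqrt (klScale klE0 j) / klScale klE0 j) ≤ 2 * Real.sqrt (klScale klE0 n) := by
  have h : ∑ j ∈ range (n + 1), klScale klE0 n * (Real.sqrt (klScale klE0 j) / klScale klE0 j) =
      Real.sqrt (klScale klE0 n) * ∑ j ∈ range (n + 1), ((1 : ℝ) / 2) ^ (n - j) := by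
    rw [mul_sum]
    refine sum_congr rfl fun j hj => ?_
    rw [mem_range] at hj
    exact klScale_mul_sqrt_div_eq (by omega)
  rw [h]
  have hgeo : ∑ j ∈ range (n + 1), ((1 : ℝ) / 2) ^ (n - j) ≤ 2 := by
    have hrefl := Finset.sum_range_reflect (fun m => ((1 : ℝ) / 2) ^ m) (n + 1)
    simp only [Nat.add_sub_cancel] at hrefl
    rw [hrefl]
    have hq0 : (0 : ℝ) ≤ 1 / 2 := by norm_num
    have hq1 : (1 : ℝ) / 2 < 1 := by norm_num
    calc ∑ m ∈ range (n + 1), ((1 : ℝ) / 2) ^ m ≤ ∑' m : ℕ, ((1 : ℝ) / 2) ^ m :=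
          Summable.sum_le_tsum _ (fun i _ => by positivity) (summable_geometric_of_lt_one hq0 hq1)
      _ = 2 := by rw [tsum_geometric_of_lt_one hq0 hq1]; norm_num
  have hs0 : 0 ≤ Real.sqrt (klScale klE0 n) := Real.sqrt_nonneg _
  nlinarith

/-- `√Λₙ ≤ 2⁻ⁿ/4` (`√klE0 ≤ 1/4`). -/
theorem sqrt_klScale_le_inv_two_pow (n : ℕ) : Real.sqrt (klScale klE0 n) ≤ ((2 : ℝ) ^ n)⁻¹ / 4 := by
  have hsc : klScale klE0 n = klE0 * ((4 : ℝ) ^ n)⁻¹ := rfl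
  have h4 : ((4 : ℝ) ^ n)⁻¹ = (((2 : ℝ) ^ n)⁻¹) ^ 2 := by
    have : (4 : ℝ) ^ n = ((2 : ℝ) ^ n) ^ 2 := by rw [sq, ← mul_pow]; norm_num
    rw [this, inv_pow]
  rw [hsc, h4, Real.sqrt_mul (by unfold klE0; norm_num), Real.sqrt_sq (by positivity)]
  have := sqrt_klE0_le_quarter
  have h2 : 0 ≤ ((2 : ℝ) ^ n)⁻¹ := by positivity
  nlinarith

/-- `Λₙ ≤ 2⁻ⁿ/32`. -/
theorem klScale_le_inv_two_pow (n : ℕ) : klScale klE0 n ≤ ((2 : ℝ) ^ n)⁻¹ / 32 := by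
  have hsc : klScale klE0 n = klE0 * ((4 : ℝ) ^ n)⁻¹ := rfl
  have he0 : klE0 = 1 / 32 := rfl
  have h42 : ((4 : ℝ) ^ n)⁻¹ ≤ ((2 : ℝ) ^ n)⁻¹ := inv_anti₀ (by positivity) (pow_le_pow_left₀ (by norm_num) (by norm_num) n)
  rw [hsc, he0]
  have : 0 ≤ ((2 : ℝ) ^ n)⁻¹ := by positivity
  nlinarith

/-- The shell count as an indicator sum: `Σ_{j ≤ n} 𝟙[Λ_j ≤ ρ] = kₙ(ρ)`. -/
theorem sum_indicator_klScale_le_eq_klShellCount (n : ℕ) (ρ : ℝ) :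
    ∑ j ∈ range (n + 1), (if klScale klE0 j ≤ ρ then (1 : ℝ) else 0) = (klShellCount n ρ : ℝ) := by
  unfold klShellCount
  rw [Finset.natCast_card_filter]

/-- The near geometric sum in indicator form: `Σ_{j ≤ n} 𝟙[ρ < Λ_j]·ρ/Λ_j ≤ 4/3`. -/
theorem sum_indicator_div_klScale_le (n : ℕ) (ρ : ℝ) :
    ∑ j ∈ range (n + 1), (if ρ < klScale klE0 j then ρ / klScale klE0 j else 0) ≤ 4 / 3 := by
  rw [← sum_filter]
  exact sum_filter_div_klScale_le (n + 1) ρ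

/-! ## §2 The bound -/

section Model

variable {L M : ℕ} [NeZero L]

set_option maxHeartbeats 1600000 in -- one long assembly of elementary inequalities over the shell ladder
/-- **«XS-PP-MASS» — THE CROSS-SCALE MASS OF THE TRANSFER WEIGHT AT A FROZEN TOTAL MOMENTUM** (module docstring). -/
theorem sum_abs_klTransferWeight_le_shellLog {R : RenConsts} (hR : R.WF2) {U : ℝ} (hU : 0 < U) (hUu : U ≤ klTSU R) {μ : ℝ} (hμ : μ ∈ klWindowC)
    {N : ℕ} {K : TrigPolyC4v} (hK : FrameOK R U N μ K) {β : ℝ} (hβ : klBetaMin ≤ β) (hβL : β ≤ (L : ℝ)) {n : ℕ} (hn : n ≤ nScales β)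
    (hGL : 8 * (4 + 8 / 3 * R.Gfr 1 * U ^ 2) * β ≤ L)
    {φ : FreqMomentum L M → ℝ} (hφ : ∀ k, 0 ≤ φ k ∧ φ k ≤ 1 - hubbardCutoffWeightCT L M β μ K (klScale klE0 n) k)
    (Qm : TorusSite 2 L) (hρ : klScale klE0 n ≤ klTorusNorm L Qm) :
    ∑ p, |klTransferWeight L M β μ K n φ Qm p| ≤
      (90 * (7 / (4 * π ^ 2) + 2 * (4 + 8 / 3 * R.Gfr 1 * U ^ 2) / π) * klTS + 2 ^ 18) *
        (klRelGain n (klTorusNorm L Qm) + ((2 : ℝ) ^ n)⁻¹) := by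
  classical
  -- names and basic facts
  set Λ : ℝ := klScale klE0 n with hΛdef
  set ρ : ℝ := klTorusNorm L Qm with hρdef
  set G : ℝ := 4 + 8 / 3 * R.Gfr 1 * U ^ 2 with hGdef
  set δ : ℝ := 2 * π / L with hδdef
  set κ : ℝ := 7 / (4 * π ^ 2) + 2 * G / π with hκdef
  have hπ := Real.pi_pos
  have hβ0 : 0 < β := pos_of_klBetaMin_le hβ
  have hL : (0 : ℝ) < L := lt_of_lt_of_le hβ0 hβL
  have hΛ : 0 < Λ := klth_klScale_pos n
  have hρ0 : 0 < ρ := hΛ.trans_le hρ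
  have hGfr : ∀ j, 0 ≤ R.Gfr j := hR.wf.2.2
  have hG4 : 4 ≤ G := by rw [hGdef]; nlinarith [hGfr 1, sq_nonneg U]
  have hG0 : 0 < G := by linarith
  have hκ0 : 0 < κ := by rw [hκdef]; positivity
  have hTS := klTS_nonneg
  have hδ0 : 0 < δ := by rw [hδdef]; positivity
  have he0 : (0 : ℝ) ≤ klE0 := by unfold klE0; norm_num
  -- thermal floor and the lattice spacing against the shell
  have hπβΛ : π / β ≤ Λ := (klth_pi_div_le_klScale_nScales hβ).trans (klScale_le_klScale he0 hn)
  have hsucc : klScale klE0 (n + 1) = Λ / 4 := klth_klScale_succ n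
  have hGδ : G * δ ≤ Λ / 4 := by
    have h1 : G * δ ≤ π / (4 * β) := by
      rw [hδdef, mul_div_assoc', div_le_div_iff₀ hL (by positivity)]
      nlinarith [hGL, hπ]
    have h2 : π / (4 * β) ≤ klScale klE0 (n + 1) := pi_div_four_mul_le_klScale_of_le_nScales_succ hβ (by omega)
    rw [hsucc] at h2
    linarith
  -- the slice sums `σ p = Σ_ν φ(ν,p)‖ĝ(ν,p)‖`, the soft sums
  set σ : TorusSite 2 L → ℝ := fun p => ∑ ν : MatsubaraIdx M, φ (ν, p) * ‖propCT L M β μ K (ν, p)‖ with hσdef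
  have hσ0 : ∀ p, 0 ≤ σ p := fun p => sum_nonneg fun ν _ => mul_nonneg (hφ _).1 (norm_nonneg _)
  set f : FreqMomentum L M → ℝ := fun k =>
    (1 - hubbardCutoffWeightCT L M β μ K Λ k) / Real.sqrt (matsubaraFreq β M k.1 ^ 2 + nambuXiCT L μ K k.2 ^ 2) with hfdef
  have hf0 : ∀ k, 0 ≤ f k := fun k => by
    have hw : hubbardCutoffWeightCT L M β μ K Λ k ≤ 1 :=
      (salmhoferCutoff_mem_Icc ((matsubaraFreq β M k.1 ^ 2 + nambuXiCT L μ K k.2 ^ 2) / Λ ^ 2)).2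
    exact div_nonneg (by linarith) (Real.sqrt_nonneg _)
  set Tall : ℝ := ∑ k : FreqMomentum L M, f k with hTall
  have hTall_le : Tall ≤ 15367 * Λ * β * (L : ℝ) ^ 2 := sum_softLine_le_of_frameOK (M := M) hK hβ0 hβL hπβΛ
  set T : ℕ → ℝ := fun j => ∑ k ∈ (univ : Finset (FreqMomentum L M)).filter (fun k => |nambuXiCT L μ K (k.2 - Qm)| ≤ klScale klE0 j), f k
    with hTdef
  have hT_le_Tall : ∀ j, T j ≤ Tall := fun j => sum_le_sum_of_subset_of_nonneg (filter_subset _ _) fun k _ _ => hf0 k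
  set I : ℕ → ℝ := fun j => ∑ p : TorusSite 2 L, (if |nambuXiCT L μ K (p - Qm)| ≤ klScale klE0 j then (1 : ℝ) else 0) * σ p with hIdef
  have hI_le_T : ∀ j, I j ≤ T j := fun j =>
    sum_indicator_slice_le_softSum β μ K hφ (fun p => |nambuXiCT L μ K (p - Qm)| ≤ klScale klE0 j)
  have hI0 : ∀ j, 0 ≤ I j := fun j => sum_nonneg fun p _ => by split_ifs <;> simp [hσ0 p]
  have hSσ : ∑ p, σ p ≤ Tall := by
    have h := sum_indicator_slice_le_softSum β μ K hφ (fun _ : TorusSite 2 L => True)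
    rw [Finset.filter_true_of_mem (fun _ _ => trivial)] at h
    simp only [if_true, one_mul] at h
    exact h
  -- the two-shell law on the shells `1 ≤ j ≤ n`, `Λ_j ≤ ρ`
  have hT_two : ∀ j ∈ range (n + 1), 1 ≤ j → klScale klE0 j ≤ ρ →
      T j ≤ 9 * klTS * ((klScale klE0 j + G * δ) / ρ + Real.sqrt (klScale klE0 j + G * δ)) * κ * Λ * β * (L : ℝ) ^ 2 := by
    intro j hj hj1 _
    rw [mem_range] at hj
    have hjn : j ≤ n := by omega
    have hΛj : Λ ≤ klScale klE0 j := klScale_le_klScale he0 hjn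
    have hΛ1 : klScale klE0 j ≤ klScale klE0 1 := klScale_le_klScale he0 hj1
    have hΛ1e : klScale klE0 1 = klE0 / 4 := by rw [klth_klScale_succ 0, klScale_klE0_zero]
    have hΛe : Λ ≤ klE0 := by have := klScale_le_klScale he0 (Nat.zero_le n); rwa [klScale_klE0_zero] at this
    have h2 : klScale klE0 j + G * (2 * π / L) ≤ klE0 := by rw [← hδdef]; linarith
    set Y : ℝ := (klScale klE0 j + G * δ) / ρ + Real.sqrt (klScale klE0 j + G * δ) with hY
    have hY0 : 0 ≤ Y := by rw [hY]; have := klth_klScale_pos j; positivity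
    have hc₁ : 0 ≤ 9 * klTS * Y / (4 * π ^ 2) := by positivity
    have hc₂ : 0 ≤ 9 * klTS * G * Y / (2 * π) := by positivity
    have hcount : ∀ η : ℝ, 0 < η → η ≤ Λ →
        (((univ : Finset (TorusSite 2 L)).filter fun p => |nambuXiCT L μ K (p - Qm)| ≤ klScale klE0 j ∧ |nambuXiCT L μ K p| < η).card : ℝ) ≤
          9 * klTS * Y / (4 * π ^ 2) * η * (L : ℝ) ^ 2 + 9 * klTS * G * Y / (2 * π) * L := by
      intro η hη hηΛ
      have h := card_twoShell_filter_le_linear hR hU hUu hμ hK h2 Qm hρ0 le_rfl hη (hηΛ.trans hΛj)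
      rw [← hδdef, ← hGdef] at h
      exact h
    have h := softSum_filter_le_linear (M := M) μ K hβ0 hΛ hπβΛ hβL hc₁ hc₂ (fun p => |nambuXiCT L μ K (p - Qm)| ≤ klScale klE0 j) hcount
    refine h.trans (le_of_eq ?_)
    rw [hκdef]
    field_simp
    ring
  -- STEP 1: under the envelope, expanded over the shells
  have h1 := sum_abs_klTransferWeight_le_env β μ K hβ0 n (fun k => (hφ k).1) Qm
  have hexp := sum_klDyadicEnv_mul_eq μ K n Qm σ
  -- STEP 2: per-shell bound `(4/Λ_j)·I_j ≤ g j`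
  set g : ℕ → ℝ := fun j =>
    45 * κ * klTS * β * (L : ℝ) ^ 2 * (Λ / ρ) * (if klScale klE0 j ≤ ρ then (1 : ℝ) else 0) +
      36 * Real.sqrt 2 * κ * klTS * β * (L : ℝ) ^ 2 * (Λ * (Real.sqrt (klScale klE0 j) / klScale klE0 j)) +
      61468 * β * (L : ℝ) ^ 2 * (32 * Λ * (if j = 0 then (1 : ℝ) else 0) + (Λ / ρ) * (if ρ < klScale klE0 j then ρ / klScale klE0 j else 0))
    with hgdef
  have hstep : ∀ j ∈ range (n + 1), (4 / klScale klE0 j) * I j ≤ g j := by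
    intro j hj
    have hjn : j ≤ n := by rw [mem_range] at hj; omega
    have hΛj0 : 0 < klScale klE0 j := klth_klScale_pos j
    have hΛj : Λ ≤ klScale klE0 j := klScale_le_klScale he0 hjn
    have hβL2 : 0 < β * (L : ℝ) ^ 2 := by positivity
    -- nonnegativity of the three summands of `g j`
    have hgA : 0 ≤ 45 * κ * klTS * β * (L : ℝ) ^ 2 * (Λ / ρ) * (if klScale klE0 j ≤ ρ then (1 : ℝ) else 0) := by
      split_ifs <;> positivity
    have hgB : 0 ≤ 36 * Real.sqrt 2 * κ * klTS * β * (L : ℝ) ^ 2 * (Λ * (Real.sqrt (klScale klE0 j) / klScale klE0 j)) := by positivity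
    have hgC1 : 0 ≤ 32 * Λ * (if j = 0 then (1 : ℝ) else 0) := by split_ifs <;> positivity
    have hgC2 : 0 ≤ (Λ / ρ) * (if ρ < klScale klE0 j then ρ / klScale klE0 j else 0) := by split_ifs <;> positivity
    by_cases hcase : 1 ≤ j ∧ klScale klE0 j ≤ ρ
    · -- two-shell shell
      have hT := hT_two j hj hcase.1 hcase.2
      have hIj := (hI_le_T j).trans hT
      have hGδj : G * δ ≤ klScale klE0 j / 4 := hGδ.trans (by linarith)
      -- transversal part: `(4/Λ_j)·9klTS·κΛβL²·(Λ_j+Gδ)/ρ ≤ 45κ klTS βL² Λ/ρ`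
      have htr : (4 / klScale klE0 j) * (9 * klTS * ((klScale klE0 j + G * δ) / ρ) * κ * Λ * β * (L : ℝ) ^ 2) ≤
          45 * κ * klTS * β * (L : ℝ) ^ 2 * (Λ / ρ) := by
        have hq : (klScale klE0 j + G * δ) / klScale klE0 j ≤ 5 / 4 := by
          rw [div_le_iff₀ hΛj0]; linarith
        have e1 : (4 / klScale klE0 j) * (9 * klTS * ((klScale klE0 j + G * δ) / ρ) * κ * Λ * β * (L : ℝ) ^ 2) =
            36 * κ * klTS * β * (L : ℝ) ^ 2 * (Λ / ρ) * ((klScale klE0 j + G * δ) / klScale klE0 j) := by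
          field_simp
          ring
        rw [e1]
        have : 0 ≤ 36 * κ * klTS * β * (L : ℝ) ^ 2 * (Λ / ρ) := by positivity
        nlinarith
      -- caustic part: `(4/Λ_j)·9klTS·κΛβL²·√(Λ_j+Gδ) ≤ 36√2 κ klTS βL²·(Λ√Λ_j/Λ_j)`
      have hca : (4 / klScale klE0 j) * (9 * klTS * Real.sqrt (klScale klE0 j + G * δ) * κ * Λ * β * (L : ℝ) ^ 2) ≤
          36 * Real.sqrt 2 * κ * klTS * β * (L : ℝ) ^ 2 * (Λ * (Real.sqrt (klScale klE0 j) / klScale klE0 j)) := by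
        have hsq : Real.sqrt (klScale klE0 j + G * δ) ≤ Real.sqrt 2 * Real.sqrt (klScale klE0 j) := by
          rw [← Real.sqrt_mul (by norm_num)]
          exact Real.sqrt_le_sqrt (by nlinarith [hδ0, hG0])
        have e1 : (4 / klScale klE0 j) * (9 * klTS * Real.sqrt (klScale klE0 j + G * δ) * κ * Λ * β * (L : ℝ) ^ 2) =
            36 * κ * klTS * β * (L : ℝ) ^ 2 * (Λ / klScale klE0 j) * Real.sqrt (klScale klE0 j + G * δ) := by
          field_simp
          ring
        have e2 : 36 * Real.sqrt 2 * κ * klTS * β * (L : ℝ) ^ 2 * (Λ * (Real.sqrt (klScale klE0 j) / klScale klE0 j)) =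
            36 * κ * klTS * β * (L : ℝ) ^ 2 * (Λ / klScale klE0 j) * (Real.sqrt 2 * Real.sqrt (klScale klE0 j)) := by
          rw [div_eq_mul_inv, div_eq_mul_inv]; ring
        rw [e1, e2]
        have : 0 ≤ 36 * κ * klTS * β * (L : ℝ) ^ 2 * (Λ / klScale klE0 j) := by positivity
        exact mul_le_mul_of_nonneg_left hsq this
      have hsplit : (4 / klScale klE0 j) * (9 * klTS * ((klScale klE0 j + G * δ) / ρ + Real.sqrt (klScale klE0 j + G * δ)) * κ * Λ * β * (L : ℝ) ^ 2) =
          (4 / klScale klE0 j) * (9 * klTS * ((klScale klE0 j + G * δ) / ρ) * κ * Λ * β * (L : ℝ) ^ 2) +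
            (4 / klScale klE0 j) * (9 * klTS * Real.sqrt (klScale klE0 j + G * δ) * κ * Λ * β * (L : ℝ) ^ 2) := by ring
      have hmain : (4 / klScale klE0 j) * I j ≤ 45 * κ * klTS * β * (L : ℝ) ^ 2 * (Λ / ρ) +
          36 * Real.sqrt 2 * κ * klTS * β * (L : ℝ) ^ 2 * (Λ * (Real.sqrt (klScale klE0 j) / klScale klE0 j)) := by
        have h4 : 0 ≤ 4 / klScale klE0 j := by positivity
        have := mul_le_mul_of_nonneg_left hIj h4
        rw [hsplit] at this
        linarith
      rw [hgdef]
      simp only [if_pos hcase.2, mul_one]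
      have hC : 0 ≤ 61468 * β * (L : ℝ) ^ 2 * (32 * Λ * (if j = 0 then (1 : ℝ) else 0) + (Λ / ρ) * (if ρ < klScale klE0 j then ρ / klScale klE0 j else 0)) :=
        by positivity
      linarith
    · -- single-shell law: `(4/Λ_j)·15367ΛβL² = 61468βL²·Λ/Λ_j`, with `j = 0` or `ρ < Λ_j`
      have hIj := ((hI_le_T j).trans (hT_le_Tall j)).trans hTall_le
      have h4 : 0 ≤ 4 / klScale klE0 j := by positivity
      have hm := mul_le_mul_of_nonneg_left hIj h4
      have e1 : (4 / klScale klE0 j) * (15367 * Λ * β * (L : ℝ) ^ 2) = 61468 * β * (L : ℝ) ^ 2 * (Λ / klScale klE0 j) := by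
        field_simp
        ring
      rw [e1] at hm
      -- `Λ/Λ_j ≤ 32Λ·𝟙[j=0] + (Λ/ρ)·𝟙[ρ<Λ_j]·ρ/Λ_j`
      have hrat : Λ / klScale klE0 j ≤ 32 * Λ * (if j = 0 then (1 : ℝ) else 0) + (Λ / ρ) * (if ρ < klScale klE0 j then ρ / klScale klE0 j else 0) := by
        rw [not_and_or] at hcase
        rcases hcase with hj0 | hbig
        · have hj0' : j = 0 := by omega
          subst hj0'
          have e32 : Λ / klScale klE0 0 = 32 * Λ := by rw [klScale_klE0_zero]; unfold klE0; ring
          rw [if_pos rfl, mul_one, e32]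
          linarith [hgC2]
        · push Not at hbig
          rw [if_pos hbig]
          have e : (Λ / ρ) * (ρ / klScale klE0 j) = Λ / klScale klE0 j := by field_simp
          rw [e]
          linarith [hgC1]
      have h61 : 0 ≤ 61468 * β * (L : ℝ) ^ 2 := by positivity
      have := mul_le_mul_of_nonneg_left hrat h61
      rw [hgdef]
      linarith [hgA, hgB]
  -- STEP 3: sum the per-shell bounds
  have hsumg : ∑ j ∈ range (n + 1), g j =
      45 * κ * klTS * β * (L : ℝ) ^ 2 * (Λ / ρ) * (klShellCount n ρ : ℝ) +
        36 * Real.sqrt 2 * κ * klTS * β * (L : ℝ) ^ 2 * ∑ j ∈ range (n + 1), Λ * (Real.sqrt (klScale klE0 j) / klScale klE0 j) +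
        61468 * β * (L : ℝ) ^ 2 * (32 * Λ * ∑ j ∈ range (n + 1), (if j = 0 then (1 : ℝ) else 0) +
          (Λ / ρ) * ∑ j ∈ range (n + 1), (if ρ < klScale klE0 j then ρ / klScale klE0 j else 0)) := by
    rw [hgdef]
    simp only [sum_add_distrib, ← mul_sum, ← sum_indicator_klScale_le_eq_klShellCount]
  have hone : ∑ j ∈ range (n + 1), (if j = 0 then (1 : ℝ) else 0) = 1 := by
    rw [sum_ite_eq' (range (n + 1)) 0 (fun _ => (1 : ℝ))]; simp
  have hcaus := sum_range_klScale_mul_sqrt_div_le n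
  have hnear := sum_indicator_div_klScale_le n ρ
  have hsqΛ := sqrt_klScale_le_inv_two_pow n
  have hΛ2 := klScale_le_inv_two_pow n
  -- STEP 4: the chain
  have hEnvSum : ∑ p : TorusSite 2 L, klDyadicEnv n (nambuXiCT L μ K (Qm - p)) * σ p ≤ ∑ j ∈ range (n + 1), g j + 32 * Tall := by
    rw [hexp]
    have hA : ∑ j ∈ range (n + 1), (4 / klScale klE0 j) * I j ≤ ∑ j ∈ range (n + 1), g j := sum_le_sum hstep
    have hB : 32 * ∑ p : TorusSite 2 L, σ p ≤ 32 * Tall := by linarith [hSσ]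
    exact add_le_add hA hB
  have hc : 0 ≤ (β * (L : ℝ) ^ 2)⁻¹ := by positivity
  have hβL2 : 0 < β * (L : ℝ) ^ 2 := by positivity
  -- put everything together
  have hk0 : (0 : ℝ) ≤ (klShellCount n ρ : ℝ) := Nat.cast_nonneg _
  have h2n : 0 < ((2 : ℝ) ^ n)⁻¹ := by positivity
  have hmin : min (ρ / Λ) (Λ / ρ) = Λ / ρ := by
    refine min_eq_right ?_
    rw [div_le_div_iff₀ hρ0 hΛ]
    nlinarith
  have hrel : klRelGain n ρ = Λ / ρ * (1 + (klShellCount n ρ : ℝ)) := by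
    unfold klRelGain; rw [hmin]
  have hsq2 : Real.sqrt 2 ≤ 3 / 2 := by
    rw [show (3 : ℝ) / 2 = Real.sqrt ((3 / 2) ^ 2) by rw [Real.sqrt_sq (by norm_num)]]
    exact Real.sqrt_le_sqrt (by norm_num)
  calc ∑ p, |klTransferWeight L M β μ K n φ Qm p|
      ≤ (β * (L : ℝ) ^ 2)⁻¹ * (2 * ∑ p : TorusSite 2 L, klDyadicEnv n (nambuXiCT L μ K (Qm - p)) * σ p) := h1
    _ ≤ (β * (L : ℝ) ^ 2)⁻¹ * (2 * (∑ j ∈ range (n + 1), g j + 32 * Tall)) :=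
        mul_le_mul_of_nonneg_left (by linarith) hc
    _ ≤ (90 * κ * klTS + 2 ^ 18) * (klRelGain n ρ + ((2 : ℝ) ^ n)⁻¹) := by
        rw [hsumg, hone, hrel]
        -- reduce to a scalar inequality: clear `(βL²)⁻¹` against the common factor `βL²`
        have eX : (β * (L : ℝ) ^ 2)⁻¹ * (2 * (45 * κ * klTS * β * (L : ℝ) ^ 2 * (Λ / ρ) * (klShellCount n ρ : ℝ) +
              36 * Real.sqrt 2 * κ * klTS * β * (L : ℝ) ^ 2 * ∑ j ∈ range (n + 1), Λ * (Real.sqrt (klScale klE0 j) / klScale klE0 j) +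
              61468 * β * (L : ℝ) ^ 2 * (32 * Λ * 1 + (Λ / ρ) * ∑ j ∈ range (n + 1), (if ρ < klScale klE0 j then ρ / klScale klE0 j else 0)) +
              32 * Tall)) =
            90 * κ * klTS * (Λ / ρ) * (klShellCount n ρ : ℝ) +
              72 * Real.sqrt 2 * κ * klTS * ∑ j ∈ range (n + 1), Λ * (Real.sqrt (klScale klE0 j) / klScale klE0 j) +
              122936 * (32 * Λ + (Λ / ρ) * ∑ j ∈ range (n + 1), (if ρ < klScale klE0 j then ρ / klScale klE0 j else 0)) +
              64 * ((β * (L : ℝ) ^ 2)⁻¹ * Tall) := by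
          field_simp
          ring
        rw [eX]
        have hT' : (β * (L : ℝ) ^ 2)⁻¹ * Tall ≤ 15367 * Λ := by
          rw [inv_mul_le_iff₀ hβL2]; linarith
        have hΛρ0 : 0 ≤ Λ / ρ := by positivity
        have hA : 90 * κ * klTS * (Λ / ρ) * (klShellCount n ρ : ℝ) ≤ 90 * κ * klTS * (Λ / ρ * (1 + (klShellCount n ρ : ℝ))) := by
          have : 0 ≤ 90 * κ * klTS * (Λ / ρ) := by positivity
          nlinarith
        have hB : 72 * Real.sqrt 2 * κ * klTS * ∑ j ∈ range (n + 1), Λ * (Real.sqrt (klScale klE0 j) / klScale klE0 j) ≤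
            90 * κ * klTS * ((2 : ℝ) ^ n)⁻¹ := by
          have h0 : 0 ≤ 72 * Real.sqrt 2 * κ * klTS := by positivity
          have := mul_le_mul_of_nonneg_left hcaus h0
          have hκT : 0 ≤ κ * klTS := by positivity
          nlinarith [mul_nonneg hκT h2n.le, Real.sqrt_nonneg 2, Real.sqrt_nonneg (klScale klE0 n)]
        have hC : 122936 * (32 * Λ + (Λ / ρ) * ∑ j ∈ range (n + 1), (if ρ < klScale klE0 j then ρ / klScale klE0 j else 0)) +
            64 * ((β * (L : ℝ) ^ 2)⁻¹ * Tall) ≤ 2 ^ 18 * (Λ / ρ * (1 + (klShellCount n ρ : ℝ)) + ((2 : ℝ) ^ n)⁻¹) := by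
          have h1' : (Λ / ρ) * ∑ j ∈ range (n + 1), (if ρ < klScale klE0 j then ρ / klScale klE0 j else 0) ≤ (Λ / ρ) * (4 / 3) :=
            mul_le_mul_of_nonneg_left hnear hΛρ0
          nlinarith [h1', hT', hΛ2, hk0, hΛρ0, hΛ.le]
        linarith [hA, hB, hC]
    _ = (90 * (7 / (4 * π ^ 2) + 2 * (4 + 8 / 3 * R.Gfr 1 * U ^ 2) / π) * klTS + 2 ^ 18) *
          (klRelGain n (klTorusNorm L Qm) + ((2 : ℝ) ^ n)⁻¹) := by rw [hκdef]

end Model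

end Summit.HubbardSuperconductivity.HubbardSuperconductivity.Theorems.KLRegimeSplit

end
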